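import Mathlib.Algebra.Order.BigOperators.Group.Finset
import Mathlib.Algebra.BigOperators.Ring.Finset
import Mathlib.Data.Real.Basic
import Mathlib.Tactic
import HarnessLib

/-!
# A kernel-decidable PSD certificate for a dense interval matrix (dyadic fixed-point Cholesky + Gershgorin budget)

Topic `Literature/NumberTheory/LFunctions` (kernel certificates of the Weil form; companion of `WeilBlockRowsFast`,
`WeilBlockRowsDCFast`).  Format C of the Weil-positivity windows (the Fourier–Galerkin / Schur certificate on Yoshida's
`K(a)`, cf. `YoshidaWindowSpaces`) ends in ONE finite statement per sector: a real symmetric `n × n` matrix `M`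
(`M = G_block − U/γ_far`), known entrywise to a common absolute precision, is positive semidefinite.  This file is the
kernel side of that statement, in the perturbation form of [cite: Rump2006PosDef, §2]:

* data: integers `mid i j` (midpoints, `M i j ∈ [(mid i j − ρ)·u, (mid i j + ρ)·u]` for a unit `u > 0` fixed by the
  user, typically `u = 2^(−2C)`), a budget `δ`, and the rows of a lower-triangular INTEGER matrix `C̃` (a fixed-point
  Cholesky factor of `mid − δ·1`, found by the generator; nothing about it is trusted);
* the checker `PsdDyadic.checkPsdMid n δ ρ mid L` computes `P := δ·1 + C̃ C̃ᵀ` EXACTLY in `ℤ` and verifies, row by row,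
  `Σ_j (|mid i j − P i j| + ρ) ≤ δ`, together with the shape conditions and the symmetry of `mid`
  (`Σ_{i,j} (min (i,j) + 1) ≈ n³/3` integer products; no rationals);
* soundness (`PsdDyadic.hyps_of_checkPsdMid`): the check implies the five hypotheses of the rational PSD certificate
  (`|M/u − P| ≤ E`, row and column sums of `E` at most `δ`, `D ≥ 0`, `P = δ·1 + Lᵀ diag(D) L` with `D = 1`), from which
  `∀ α, 0 ≤ Σ α_i α_j M i j` follows by the Cholesky–Gershgorin argument (`PsdDyadic.psd_of_checkPsdMid`).

Data files carry each matrix row as ONE natural-number literal (`unpackRow`: `w`-bit words, offset `2^(w−1)`), unpacked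
inside the kernel by `%` and `/` — this keeps elaboration linear in the file size.  Everything here is proved. [folklore]
-/

open Finset
open scoped BigOperators

namespace Literature.NumberTheory.LFunctions

namespace PsdDyadic

/-! ## The checker (structural list recursion; reduces well in the kernel) -/

/-- `|a|` on `ℤ` by cases (kernel-friendly). [folklore] -/
def absZ (a : ℤ) : ℤ := if a < 0 then -a else a

/-- Dot product of two integer lists, truncating to the shorter. [folklore] -/
def dotZ : List ℤ → List ℤ → ℤ
  | [], _ => 0
  | _ :: _, [] => 0
  | a :: as, b :: bs => a * b + dotZ as bs

/-- `Σ_j (|mid_ij − P_ij| + ρ)` along row `i`, `P_ij = ⟨row_i, row_j⟩ + δ·[j = i]`; `j` is the running column index,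
`ms` the remaining midpoints of row `i`, `rs` the remaining rows of the factor. [folklore] -/
def rowErrSumMid (δ ρ : ℤ) (ri : List ℤ) (i : ℕ) : ℕ → List ℤ → List (List ℤ) → ℤ
  | _, [], _ => 0
  | _, _ :: _, [] => 0
  | j, m :: ms, rj :: rs =>
      (absZ (m - (dotZ ri rj + if j = i then δ else 0)) + ρ) + rowErrSumMid δ ρ ri i (j + 1) ms rs

/-- All row budgets from row `i` on: `ms` = remaining rows of `mid`, `ris` = remaining rows of the factor,
`rows` = ALL rows of the factor. [folklore] -/
def checkRowsMid (δ ρ : ℤ) (rows : List (List ℤ)) : ℕ → List (List ℤ) → List (List ℤ) → Bool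
  | _, [], [] => true
  | _, [], _ :: _ => false
  | _, _ :: _, [] => false
  | i, mi :: ms, ri :: ris => decide (rowErrSumMid δ ρ ri i 0 mi rows ≤ δ) && checkRowsMid δ ρ rows (i + 1) ms ris

/-- `(i, j)` entry of an integer list matrix (zero beyond the ends). [folklore] -/
def getMZ (A : List (List ℤ)) (i j : ℕ) : ℤ := (A.getD i []).getD j 0

/-- `∀ k < n, P k` by structural recursion. [folklore] -/
def allBelowN (n : ℕ) (P : ℕ → Bool) : Bool := Nat.rec true (fun k acc ↦ acc && P k) n

/-- Symmetry of the `n × n` part of `mid`, by indexed access. [folklore] -/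
def symmCheck (n : ℕ) (mid : List (List ℤ)) : Bool :=
  allBelowN n fun i ↦ allBelowN i fun j ↦ decide (getMZ mid i j = getMZ mid j i)

/-- THE CHECKER: shapes (`n` rows of `mid` of length `n`; `n` rows of the factor of length `≤ n`), symmetry of `mid`,
and every row budget `Σ_j (|mid_ij − P_ij| + ρ) ≤ δ`. [folklore] -/
def checkPsdMid (n : ℕ) (δ ρ : ℤ) (mid L : List (List ℤ)) : Bool :=
  decide (mid.length = n) && decide (L.length = n) && mid.all (fun r ↦ decide (r.length = n))
    && L.all (fun r ↦ decide (r.length ≤ n)) && symmCheck n mid && checkRowsMid δ ρ L 0 mid L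

/-! ## Packed data rows -/

/-- Unpack `k` words of width `w` (`Mw = 2^w`, `off = 2^(w−1)`) of `r` into signed entries. [folklore] -/
def unpackRow (Mw off : ℕ) (r : ℕ) : ℕ → List ℤ
  | 0 => []
  | k + 1 => (((r % Mw : ℕ) : ℤ) - (off : ℤ)) :: unpackRow Mw off (r / Mw) k

/-- Unpack an `n × n` matrix given as `n` packed rows. [folklore] -/
def unpackSq (w n : ℕ) (rows : List ℕ) : List (List ℤ) :=
  rows.map fun r ↦ unpackRow (2 ^ w) (2 ^ (w - 1)) r n

/-- Unpack lower-triangular rows (row `i` has `i + 1` entries), starting at row index `i`. [folklore] -/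
def unpackTriFrom (Mw off : ℕ) : ℕ → List ℕ → List (List ℤ)
  | _, [] => []
  | i, r :: rs => unpackRow Mw off r (i + 1) :: unpackTriFrom Mw off (i + 1) rs

/-- Unpack a packed lower-triangular factor. [folklore] -/
def unpackTri (w : ℕ) (rows : List ℕ) : List (List ℤ) := unpackTriFrom (2 ^ w) (2 ^ (w - 1)) 0 rows

/-! ## Bookkeeping: the recursions as sums -/

/-- `absZ = |·|`. [folklore] -/
private theorem absZ_eq_abs (a : ℤ) : absZ a = |a| := by
  unfold absZ; split_ifs with h
  · exact (abs_of_neg h).symm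
  · exact (abs_of_nonneg (not_lt.1 h)).symm

/-- `∀ k < n, P k` from `allBelowN`. [folklore] -/
private theorem of_allBelowN {n : ℕ} {P : ℕ → Bool} (h : allBelowN n P = true) {k : ℕ} (hk : k < n) : P k = true := by
  induction n with
  | zero => exact absurd hk (Nat.not_lt_zero _)
  | succ n ih =>
    have h' : (allBelowN n P && P n) = true := h
    rw [Bool.and_eq_true] at h'
    rcases Nat.lt_succ_iff_lt_or_eq.1 hk with hk' | rfl
    · exact ih h'.1 hk'
    · exact h'.2

/-- A truncating dot product is the sum over any range covering both lists. [folklore] -/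
private theorem dotZ_eq_sum : ∀ (as bs : List ℤ) (N : ℕ), as.length ≤ N → bs.length ≤ N →
    dotZ as bs = ∑ l ∈ Finset.range N, as.getD l 0 * bs.getD l 0
  | [], bs, N, _, _ => by simp [dotZ]
  | _ :: _, [], N, _, _ => by simp [dotZ]
  | a :: as, b :: bs, N, ha, hb => by
      obtain ⟨N, rfl⟩ : ∃ N', N = N' + 1 := ⟨N - 1, by simp at ha; omega⟩
      rw [dotZ, dotZ_eq_sum as bs N (by simpa using ha) (by simpa using hb), Finset.sum_range_succ']
      simp only [List.getD_cons_succ, List.getD_cons_zero, add_comm]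

/-- The row error sum as a `Finset` sum (offset form). [folklore] -/
private theorem rowErrSumMid_eq (δ ρ : ℤ) (ri : List ℤ) (i : ℕ) : ∀ (ms : List ℤ) (rs : List (List ℤ)) (j₀ : ℕ),
    ms.length = rs.length →
    rowErrSumMid δ ρ ri i j₀ ms rs =
      ∑ t ∈ Finset.range ms.length,
        (|ms.getD t 0 - (dotZ ri (rs.getD t []) + if j₀ + t = i then δ else 0)| + ρ)
  | [], _, j₀, _ => by simp [rowErrSumMid]
  | _ :: _, [], j₀, h => by simp at h
  | m :: ms, rj :: rs, j₀, h => by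
      rw [rowErrSumMid, rowErrSumMid_eq δ ρ ri i ms rs (j₀ + 1) (by simpa using h), List.length_cons,
        Finset.sum_range_succ', absZ_eq_abs]
      simp only [List.getD_cons_succ, List.getD_cons_zero, add_zero, add_comm, add_left_comm, add_assoc]

/-- What `checkRowsMid` certifies: equal lengths and every row budget (offset form). [folklore] -/
private theorem checkRowsMid_spec (δ ρ : ℤ) (rows : List (List ℤ)) : ∀ (ms ris : List (List ℤ)) (i₀ : ℕ),
    checkRowsMid δ ρ rows i₀ ms ris = true →
    ms.length = ris.length ∧ ∀ t < ms.length, rowErrSumMid δ ρ (ris.getD t []) (i₀ + t) 0 (ms.getD t []) rows ≤ δ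
  | [], [], i₀, _ => ⟨rfl, fun t ht ↦ absurd ht (Nat.not_lt_zero _)⟩
  | [], _ :: _, i₀, h => by simp [checkRowsMid] at h
  | _ :: _, [], i₀, h => by simp [checkRowsMid] at h
  | mi :: ms, ri :: ris, i₀, h => by
      rw [checkRowsMid, Bool.and_eq_true, decide_eq_true_eq] at h
      obtain ⟨hlen, hrest⟩ := checkRowsMid_spec δ ρ rows ms ris (i₀ + 1) h.2
      refine ⟨by simp [hlen], fun t ht ↦ ?_⟩
      cases t with
      | zero => simpa using h.1
      | succ t =>
        have := hrest t (by simpa using ht)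
        simpa [List.getD_cons_succ, show i₀ + 1 + t = i₀ + (t + 1) by omega] using this

/-! ## Soundness: the five hypotheses of the rational PSD certificate, then PSD -/

variable {n : ℕ} {δ ρ : ℤ} {mid L : List (List ℤ)}

/-- The factor entry `C̃_{ir}` (row `i`, column `r`; zero beyond the stored triangle). [folklore] -/
def facZ (L : List (List ℤ)) (i r : ℕ) : ℤ := getMZ L i r

/-- `P = δ·1 + C̃ C̃ᵀ` as an integer function on `Fin n`. [folklore] -/
def pZ (n : ℕ) (δ : ℤ) (L : List (List ℤ)) (i j : Fin n) : ℤ :=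
  δ * (if i = j then 1 else 0) + ∑ r : Fin n, facZ L i r * facZ L j r

/-- `E = |mid − P| + ρ`. [folklore] -/
def eZ (n : ℕ) (δ ρ : ℤ) (mid L : List (List ℤ)) (i j : Fin n) : ℤ :=
  |getMZ mid i j - pZ n δ L i j| + ρ

/-- Unpacking the Boolean check. [folklore] -/
private theorem spec_of_checkPsdMid (h : checkPsdMid n δ ρ mid L = true) :
    mid.length = n ∧ L.length = n ∧ (∀ r ∈ mid, r.length = n) ∧ (∀ r ∈ L, r.length ≤ n) ∧
      (∀ i j : ℕ, j < i → i < n → getMZ mid i j = getMZ mid j i) ∧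
      ∀ t < n, rowErrSumMid δ ρ (L.getD t []) t 0 (mid.getD t []) L ≤ δ := by
  unfold checkPsdMid at h
  simp only [Bool.and_eq_true, decide_eq_true_eq, List.all_eq_true] at h
  obtain ⟨⟨⟨⟨⟨hml, hLl⟩, hmr⟩, hLr⟩, hsy⟩, hrows⟩ := h
  obtain ⟨-, hr⟩ := checkRowsMid_spec δ ρ L mid L 0 hrows
  refine ⟨hml, hLl, hmr, hLr, fun i j hji hin ↦ ?_, fun t ht ↦ by simpa [hml] using hr t (hml ▸ ht)⟩
  have h1 := of_allBelowN hsy hin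
  have h2 := of_allBelowN h1 hji
  simpa using h2

/-- The dot product of two stored factor rows is `Σ_{r<n} C̃_{ir} C̃_{jr}`. [folklore] -/
private theorem dotZ_rows (h : checkPsdMid n δ ρ mid L = true) (i j : Fin n) :
    dotZ (L.getD i []) (L.getD j []) = ∑ r : Fin n, facZ L i r * facZ L j r := by
  obtain ⟨-, hLl, -, hLr, -, -⟩ := spec_of_checkPsdMid h
  have hlen : ∀ k : Fin n, (L.getD k []).length ≤ n := fun k ↦ by
    rw [List.getD_eq_getElem?_getD, List.getElem?_eq_getElem (by rw [hLl]; exact k.2), Option.getD_some]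
    exact hLr _ (List.getElem_mem _)
  rw [dotZ_eq_sum _ _ n (hlen i) (hlen j), Finset.sum_range]
  rfl

/-- `P` is symmetric. [folklore] -/
private theorem pZ_comm (i j : Fin n) : pZ n δ L i j = pZ n δ L j i := by
  unfold pZ
  by_cases hij : i = j
  · subst hij; rfl
  · rw [if_neg hij, if_neg (Ne.symm hij)]
    congr 1
    exact Finset.sum_congr rfl fun r _ ↦ mul_comm _ _

/-- `E` is symmetric (uses the symmetry check of `mid`). [folklore] -/
private theorem eZ_comm (h : checkPsdMid n δ ρ mid L = true) (i j : Fin n) :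
    eZ n δ ρ mid L i j = eZ n δ ρ mid L j i := by
  obtain ⟨-, -, -, -, hsy, -⟩ := spec_of_checkPsdMid h
  unfold eZ
  rw [pZ_comm]
  rcases lt_trichotomy (j : ℕ) i with hji | hij | hij
  · rw [hsy i j hji i.2]
  · rw [Fin.ext hij.symm]
  · rw [← hsy j i hij j.2]

/-- Row `i` of `E` sums to at most `δ`. [folklore] -/
private theorem eZ_row_le (h : checkPsdMid n δ ρ mid L = true) (i : Fin n) : ∑ j : Fin n, eZ n δ ρ mid L i j ≤ δ := by
  obtain ⟨hml, hLl, hmr, -, -, hrows⟩ := spec_of_checkPsdMid h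
  have hmi : (mid.getD i []).length = n := by
    rw [List.getD_eq_getElem?_getD, List.getElem?_eq_getElem (by rw [hml]; exact i.2), Option.getD_some]
    exact hmr _ (List.getElem_mem _)
  have key := hrows i i.2
  rw [rowErrSumMid_eq δ ρ _ _ _ _ 0 (by rw [hmi, hLl]), hmi, Finset.sum_range] at key
  have hin : ∀ j : Fin n, (dotZ (L.getD i []) (L.getD j []) + if 0 + (j : ℕ) = i then δ else 0) = pZ n δ L i j := by
    intro j
    unfold pZ
    rw [dotZ_rows h i j]
    by_cases hij : i = j
    · subst hij; simp [add_comm]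
    · have hne : ¬ (0 + (j : ℕ) = i) := by
        intro hc; exact hij (Fin.ext (by omega))
      rw [if_neg hne, if_neg hij, mul_zero, zero_add, add_zero]
  calc ∑ j : Fin n, eZ n δ ρ mid L i j
      = ∑ j : Fin n, (|(mid.getD i []).getD j 0 - (dotZ (L.getD i []) (L.getD j []) + if 0 + (j : ℕ) = i then δ else 0)| + ρ) :=
        Finset.sum_congr rfl fun j _ ↦ by unfold eZ getMZ; rw [hin j]
    _ ≤ δ := key

/-- Column `j` of `E` sums to at most `δ`. [folklore] -/
private theorem eZ_col_le (h : checkPsdMid n δ ρ mid L = true) (j : Fin n) : ∑ i : Fin n, eZ n δ ρ mid L i j ≤ δ := by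
  rw [Finset.sum_congr rfl fun i _ ↦ eZ_comm h i j]
  exact eZ_row_le h j

/-- **The budget in real form**: if `|M i j − mid_ij·u| ≤ ρ·u` then `|M i j / u − P i j| ≤ E i j`. [folklore] -/
private theorem near_of_enclosure {u : ℝ} (hu : 0 < u) {M : Fin n → Fin n → ℝ}
    (hM : ∀ i j, |M i j - (getMZ mid i j : ℝ) * u| ≤ (ρ : ℝ) * u) (i j : Fin n) :
    |M i j / u - (pZ n δ L i j : ℝ)| ≤ (eZ n δ ρ mid L i j : ℝ) := by
  have h1 : |M i j / u - (getMZ mid i j : ℝ)| ≤ ρ := by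
    have := hM i j
    rw [show M i j / u - (getMZ mid i j : ℝ) = (M i j - (getMZ mid i j : ℝ) * u) / u by field_simp]
    rw [abs_div, abs_of_pos hu, div_le_iff₀ hu]
    exact this
  have h2 : ((eZ n δ ρ mid L i j : ℤ) : ℝ) = |(getMZ mid i j : ℝ) - (pZ n δ L i j : ℝ)| + ρ := by
    unfold eZ; push_cast; rfl
  rw [h2]
  calc |M i j / u - (pZ n δ L i j : ℝ)|
      = |(M i j / u - (getMZ mid i j : ℝ)) + ((getMZ mid i j : ℝ) - (pZ n δ L i j : ℝ))| := by ring_nf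
    _ ≤ |M i j / u - (getMZ mid i j : ℝ)| + |(getMZ mid i j : ℝ) - (pZ n δ L i j : ℝ)| := abs_add_le _ _
    _ ≤ ρ + |(getMZ mid i j : ℝ) - (pZ n δ L i j : ℝ)| := by gcongr
    _ = |(getMZ mid i j : ℝ) - (pZ n δ L i j : ℝ)| + ρ := add_comm _ _

/-- **Cholesky–Gershgorin**: `P = d·1 + C Cᵀ`, `|N − P| ≤ E` with row and column sums of `E` at most `d`
`⇒ ∀ α, 0 ≤ Σ α_i α_j N i j`. [cite: Rump2006PosDef, §2] -/
theorem psd_of_near {N P E : Fin n → Fin n → ℝ} {d : ℝ} (C : Fin n → Fin n → ℝ)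
    (hP : ∀ i j, P i j = d * (if i = j then 1 else 0) + ∑ r, C i r * C j r)
    (hE : ∀ i j, |N i j - P i j| ≤ E i j) (hrow : ∀ i, ∑ j, E i j ≤ d) (hcol : ∀ j, ∑ i, E i j ≤ d)
    (α : Fin n → ℝ) : 0 ≤ ∑ i, ∑ j, α i * α j * N i j := by
  have hE0 : ∀ i j, 0 ≤ E i j := fun i j ↦ (abs_nonneg _).trans (hE i j)
  -- (1) the diagonal part of `P`
  have hdiag : ∑ i, ∑ j, α i * α j * (d * (if i = j then 1 else 0)) = d * ∑ i, α i ^ 2 := by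
    have : ∀ i : Fin n, ∑ j, α i * α j * (d * (if i = j then 1 else 0)) = d * α i ^ 2 := fun i ↦ by
      rw [Finset.sum_eq_single i (fun j _ hji ↦ by simp [Ne.symm hji]) (fun hi ↦ absurd (Finset.mem_univ i) hi)]
      simp; ring
    rw [Finset.sum_congr rfl fun i _ ↦ this i, Finset.mul_sum]
  -- (2) the Gram part of `P`
  have hgram : ∑ i, ∑ j, α i * α j * ∑ r, C i r * C j r = ∑ r, (∑ i, α i * C i r) ^ 2 := by
    calc ∑ i, ∑ j, α i * α j * ∑ r, C i r * C j r
        = ∑ i, ∑ j, ∑ r, (α i * C i r) * (α j * C j r) := by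
          refine Finset.sum_congr rfl fun i _ ↦ Finset.sum_congr rfl fun j _ ↦ ?_
          rw [Finset.mul_sum]
          exact Finset.sum_congr rfl fun r _ ↦ by ring
      _ = ∑ i, ∑ r, ∑ j, (α i * C i r) * (α j * C j r) := Finset.sum_congr rfl fun i _ ↦ Finset.sum_comm
      _ = ∑ r, ∑ i, ∑ j, (α i * C i r) * (α j * C j r) := Finset.sum_comm
      _ = ∑ r, (∑ i, α i * C i r) ^ 2 := by
          refine Finset.sum_congr rfl fun r _ ↦ ?_
          rw [sq, Finset.sum_mul_sum]
  have hPq : ∑ i, ∑ j, α i * α j * P i j = d * ∑ i, α i ^ 2 + ∑ r, (∑ i, α i * C i r) ^ 2 := by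
    rw [← hdiag, ← hgram, ← Finset.sum_add_distrib]
    refine Finset.sum_congr rfl fun i _ ↦ ?_
    rw [← Finset.sum_add_distrib]
    exact Finset.sum_congr rfl fun j _ ↦ by rw [hP i j]; ring
  -- (3) the perturbation is dominated by the budget
  have hpt : ∀ i j, α i * α j * (P i j - N i j) ≤ (α i ^ 2 / 2) * E i j + (α j ^ 2 / 2) * E i j := fun i j ↦ by
    have hab : |α i| * |α j| ≤ α i ^ 2 / 2 + α j ^ 2 / 2 := by
      nlinarith [sq_nonneg (|α i| - |α j|), sq_abs (α i), sq_abs (α j)]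
    calc α i * α j * (P i j - N i j) ≤ |α i * α j * (P i j - N i j)| := le_abs_self _
      _ = |α i| * |α j| * |N i j - P i j| := by rw [abs_mul, abs_mul, abs_sub_comm]
      _ ≤ |α i| * |α j| * E i j := by gcongr; exact hE i j
      _ ≤ (α i ^ 2 / 2 + α j ^ 2 / 2) * E i j := mul_le_mul_of_nonneg_right hab (hE0 i j)
      _ = (α i ^ 2 / 2) * E i j + (α j ^ 2 / 2) * E i j := by ring
  have hA : ∑ i, ∑ j, (α i ^ 2 / 2) * E i j ≤ ∑ i, (α i ^ 2 / 2) * d := Finset.sum_le_sum fun i _ ↦ by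
    rw [← Finset.mul_sum]; exact mul_le_mul_of_nonneg_left (hrow i) (by positivity)
  have hB : ∑ i, ∑ j, (α j ^ 2 / 2) * E i j ≤ ∑ j, (α j ^ 2 / 2) * d := by
    rw [Finset.sum_comm]
    exact Finset.sum_le_sum fun j _ ↦ by rw [← Finset.mul_sum]; exact mul_le_mul_of_nonneg_left (hcol j) (by positivity)
  have hdiff : ∑ i, ∑ j, α i * α j * (P i j - N i j) ≤ d * ∑ i, α i ^ 2 := by
    calc ∑ i, ∑ j, α i * α j * (P i j - N i j)
        ≤ ∑ i, ∑ j, ((α i ^ 2 / 2) * E i j + (α j ^ 2 / 2) * E i j) :=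
          Finset.sum_le_sum fun i _ ↦ Finset.sum_le_sum fun j _ ↦ hpt i j
      _ = ∑ i, ∑ j, (α i ^ 2 / 2) * E i j + ∑ i, ∑ j, (α j ^ 2 / 2) * E i j := by
          rw [← Finset.sum_add_distrib]
          exact Finset.sum_congr rfl fun i _ ↦ Finset.sum_add_distrib
      _ ≤ ∑ i, (α i ^ 2 / 2) * d + ∑ j, (α j ^ 2 / 2) * d := add_le_add hA hB
      _ = d * ∑ i, α i ^ 2 := by
          rw [← Finset.sum_add_distrib, Finset.mul_sum]
          exact Finset.sum_congr rfl fun i _ ↦ by ring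
  -- (4) assemble
  have hsq : 0 ≤ ∑ r, (∑ i, α i * C i r) ^ 2 := Finset.sum_nonneg fun r _ ↦ sq_nonneg _
  have hsplit : ∑ i, ∑ j, α i * α j * N i j
      = ∑ i, ∑ j, α i * α j * P i j - ∑ i, ∑ j, α i * α j * (P i j - N i j) := by
    rw [← Finset.sum_sub_distrib]
    refine Finset.sum_congr rfl fun i _ ↦ ?_
    rw [← Finset.sum_sub_distrib]
    exact Finset.sum_congr rfl fun j _ ↦ by ring
  rw [hsplit, hPq]
  linarith

/-- **Soundness of the kernel PSD check.**  If `checkPsdMid n δ ρ mid L = true` and the real symmetric matrix `M` is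
enclosed by the integer midpoints, `|M i j − mid_ij·u| ≤ ρ·u` for some unit `u > 0`, then `M` is positive semidefinite
as a quadratic form. [cite: Rump2006PosDef, §2] -/
theorem psd_of_checkPsdMid (h : checkPsdMid n δ ρ mid L = true) {u : ℝ} (hu : 0 < u) (M : Fin n → Fin n → ℝ)
    (hM : ∀ i j, |M i j - (getMZ mid i j : ℝ) * u| ≤ (ρ : ℝ) * u) (α : Fin n → ℝ) :
    0 ≤ ∑ i, ∑ j, α i * α j * M i j := by
  have hN := psd_of_near (N := fun i j ↦ M i j / u) (P := fun i j ↦ (pZ n δ L i j : ℝ))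
    (E := fun i j ↦ (eZ n δ ρ mid L i j : ℝ)) (d := (δ : ℝ)) (fun i r ↦ (facZ L i r : ℝ))
    (fun i j ↦ by simp only [pZ, Int.cast_add, Int.cast_mul, Int.cast_sum, Int.cast_ite, Int.cast_one, Int.cast_zero])
    (near_of_enclosure hu hM)
    (fun i ↦ by exact_mod_cast eZ_row_le h i) (fun j ↦ by exact_mod_cast eZ_col_le h j) α
  have : ∑ i, ∑ j, α i * α j * M i j = u * ∑ i, ∑ j, α i * α j * (M i j / u) := by
    rw [Finset.mul_sum]; refine Finset.sum_congr rfl fun i _ ↦ ?_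
    rw [Finset.mul_sum]; exact Finset.sum_congr rfl fun j _ ↦ by field_simp
  rw [this]
  exact mul_nonneg hu.le hN

end PsdDyadic

end Literature.NumberTheory.LFunctions

/-! ## Row bands: splitting the `O(n³)` check across files (appended 2026-08-22, rh-explicit weil-2 gen2)

For blocks beyond `n ≈ 150` the single `decide` exceeds the farm's per-file budget (measured `≈ 7·10⁻⁵·n³` s).  The check
is row-separable: `checkPsdShape` (shapes + symmetry, cheap) and one `checkPsdBand … i₀ k` per band of rows
`i₀ ≤ t < i₀ + k` (each its own file); the reassembly theorems live in
`Summits/RiemannHypothesis/RiemannHypothesis/Theorems/FormatCPsdBands.lean`. -/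

namespace Literature.NumberTheory.LFunctions

namespace PsdDyadic

/-- Shapes (`n` rows of `mid` of length `n`; `n` factor rows of length `≤ n`) and symmetry of `mid` — the data-only part of
`checkPsdMid`. [folklore] -/
def checkPsdShape (n : ℕ) (mid L : List (List ℤ)) : Bool :=
  decide (mid.length = n) && decide (L.length = n) && mid.all (fun r ↦ decide (r.length = n))
    && L.all (fun r ↦ decide (r.length ≤ n)) && symmCheck n mid

/-- The row budgets of the band `i₀ ≤ t < i₀ + k` only (rows `i₀ … i₀+k−1` of `mid` and of the factor, against ALL factor
rows). [folklore] -/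
def checkPsdBand (δ ρ : ℤ) (mid L : List (List ℤ)) (i₀ k : ℕ) : Bool :=
  checkRowsMid δ ρ L i₀ ((mid.drop i₀).take k) ((L.drop i₀).take k)

end PsdDyadic

end Literature.NumberTheory.LFunctions

/-! ## `O(n²)` shape check (appended 2026-08-22, rh-explicit weil-2 gen2)

`symmCheck` (indexed access) costs `O(n³)` kernel steps (measured 32 s at n = 104); for blocks `n ≥ 200` use
`checkPsdShapeFast` (lengths + `transposeZ mid = mid`, `O(n²)`); the implication `checkPsdShapeFast → checkPsdShape` is
`Summits/…/Theorems/FormatCPsdBands.lean: checkPsdShape_of_fast`. -/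

namespace Literature.NumberTheory.LFunctions

namespace PsdDyadic

/-- Transpose of a rectangular integer list matrix by structural recursion (`O(rows·cols)` kernel steps). [folklore] -/
def transposeZ : List (List ℤ) → List (List ℤ)
  | [] => []
  | [r] => r.map fun x ↦ [x]
  | r :: r' :: rs => List.zipWith List.cons r (transposeZ (r' :: rs))

/-- O(n²) shape check: lengths and `transposeZ mid = mid`. [folklore] -/
def checkPsdShapeFast (n : ℕ) (mid L : List (List ℤ)) : Bool :=
  decide (mid.length = n) && decide (L.length = n) && mid.all (fun r ↦ decide (r.length = n))
    && L.all (fun r ↦ decide (r.length ≤ n)) && (transposeZ mid == mid)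

end PsdDyadic

end Literature.NumberTheory.LFunctions
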